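import Mathlib
import Summits.Ventures.PercRepro2.SortedPairs5Swap

/-!
# Sorted labellings of 5 pairs of points, III: the orbit minimum is sorted (blind cell PercRepro2, night-3, 2026-08-24)

Exchanging two misordered consecutive pairs lowers the code (`code10_exch5_lt_k`); with the swap
lemmas, the member of least code in the orbit of a list of 5 pairs under pair permutations and
end swaps (`act5`) is SORTED (`exists_sorted5`) — the coverage lemma of the fully
symmetry-reduced enumeration of the labellings of 5 typed edges.
-/

namespace Summit.Ventures.PercRepro2

open UnionCluster

namespace CovForm

namespace TwoTyped

open OneTyped

section Sorted5

open Classical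

variable {V : Type*} {E : Type*} (ends : E → Sym2 V) (o a₁ a₂ a₃ b : V) (ω : Config E)

/-- Exchanging pairs `0` and `1` changes no point before index `5`. -/
lemma pt_exch5_0 (ps : Fin 5 → V × V) (j : ℕ) (hj : j ≤ 4) :
    pt o a₁ a₂ a₃ b (xsOf5 (exch5 ps 0)) j = pt o a₁ a₂ a₃ b (xsOf5 ps) j := by
  interval_cases j <;> rfl

/-- **Exchanging two misordered pairs lowers the code** (pairs `0` and `1`). -/
lemma code10_exch5_lt_0 (ps : Fin 5 → V × V)
    (h : lab ends o a₁ a₂ a₃ b (xsOf5 ps) ω 7 < lab ends o a₁ a₂ a₃ b (xsOf5 ps) ω 5 ∨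
      (lab ends o a₁ a₂ a₃ b (xsOf5 ps) ω 7 = lab ends o a₁ a₂ a₃ b (xsOf5 ps) ω 5 ∧ lab ends o a₁ a₂ a₃ b (xsOf5 ps) ω 8 < lab ends o a₁ a₂ a₃ b (xsOf5 ps) ω 6)) :
    code10 ends o a₁ a₂ a₃ b ω (xsOf5 (exch5 ps 0)) < code10 ends o a₁ a₂ a₃ b ω (xsOf5 ps) := by
  have hpre : ∀ j ≤ 4, pt o a₁ a₂ a₃ b (xsOf5 (exch5 ps 0)) j = pt o a₁ a₂ a₃ b (xsOf5 ps) j := pt_exch5_0 o a₁ a₂ a₃ b ps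
  have hleP := lab_le ends o a₁ a₂ a₃ b (xsOf5 ps) ω 5
  have hleP1 := lab_le ends o a₁ a₂ a₃ b (xsOf5 ps) ω 6
  have hs2 := lab_spec ends o a₁ a₂ a₃ b (xsOf5 ps) ω 7
  have hs3 := lab_spec ends o a₁ a₂ a₃ b (xsOf5 ps) ω 8
  have hmin2 : ∀ n, n < lab ends o a₁ a₂ a₃ b (xsOf5 ps) ω 7 → ¬ Conn ends ω (pt o a₁ a₂ a₃ b (xsOf5 ps) n) (pt o a₁ a₂ a₃ b (xsOf5 ps) 7) :=
    fun n hn => Nat.find_min (⟨7, conn_refl ends ω (pt o a₁ a₂ a₃ b (xsOf5 ps) 7)⟩ :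
      ∃ j, Conn ends ω (pt o a₁ a₂ a₃ b (xsOf5 ps) j) (pt o a₁ a₂ a₃ b (xsOf5 ps) 7)) hn
  rcases h with hA | ⟨hB1, hB2⟩
  · have hj : lab ends o a₁ a₂ a₃ b (xsOf5 ps) ω 7 ≤ 4 := by omega
    have hnew : lab ends o a₁ a₂ a₃ b (xsOf5 (exch5 ps 0)) ω 5 ≤ lab ends o a₁ a₂ a₃ b (xsOf5 ps) ω 7 :=
      Nat.find_min' (p := fun j => Conn ends ω (pt o a₁ a₂ a₃ b (xsOf5 (exch5 ps 0)) j) (pt o a₁ a₂ a₃ b (xsOf5 (exch5 ps 0)) 5))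
        ⟨5, conn_refl ends ω _⟩ (by rw [hpre _ hj]; simpa [exch5] using hs2)
    refine code10_lt_0 ends o a₁ a₂ a₃ b ω (xsOf5 ps) (xsOf5 (exch5 ps 0))  ?_
    omega
  · have hv : lab ends o a₁ a₂ a₃ b (xsOf5 (exch5 ps 0)) ω 5 = lab ends o a₁ a₂ a₃ b (xsOf5 ps) ω 5 := by
      apply le_antisymm
      · rcases Nat.lt_or_ge (lab ends o a₁ a₂ a₃ b (xsOf5 ps) ω 5) 5 with hlt | hge
        · refine Nat.find_min' (p := fun j => Conn ends ω (pt o a₁ a₂ a₃ b (xsOf5 (exch5 ps 0)) j) (pt o a₁ a₂ a₃ b (xsOf5 (exch5 ps 0)) 5))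
            ⟨5, conn_refl ends ω _⟩ ?_
          rw [hpre _ (by omega), ← hB1]
          simpa [exch5] using hs2
        · have := lab_le ends o a₁ a₂ a₃ b (xsOf5 (exch5 ps 0)) ω 5
          omega
      · by_contra hlt
        simp only [not_le] at hlt
        have hs' := lab_spec ends o a₁ a₂ a₃ b (xsOf5 (exch5 ps 0)) ω 5
        rw [hpre _ (by omega)] at hs'
        exact hmin2 (lab ends o a₁ a₂ a₃ b (xsOf5 (exch5 ps 0)) ω 5) (by omega) (by simpa [exch5] using hs')
    have hnew : lab ends o a₁ a₂ a₃ b (xsOf5 (exch5 ps 0)) ω 6 < lab ends o a₁ a₂ a₃ b (xsOf5 ps) ω 6 := by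
      rcases Nat.lt_or_ge (lab ends o a₁ a₂ a₃ b (xsOf5 ps) ω 8) 5 with hlt | hge
      · have : lab ends o a₁ a₂ a₃ b (xsOf5 (exch5 ps 0)) ω 6 ≤ lab ends o a₁ a₂ a₃ b (xsOf5 ps) ω 8 :=
          Nat.find_min' (p := fun j => Conn ends ω (pt o a₁ a₂ a₃ b (xsOf5 (exch5 ps 0)) j) (pt o a₁ a₂ a₃ b (xsOf5 (exch5 ps 0)) 6))
            ⟨6, conn_refl ends ω _⟩ (by rw [hpre _ (by omega)]; simpa [exch5] using hs3)
        omega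
      · have hj3 : lab ends o a₁ a₂ a₃ b (xsOf5 ps) ω 8 = 5 := by omega
        rw [hj3] at hs3
        have hpp : Conn ends ω (pt o a₁ a₂ a₃ b (xsOf5 ps) 5) (pt o a₁ a₂ a₃ b (xsOf5 ps) 7) :=
          (lab_eq_iff ends o a₁ a₂ a₃ b (xsOf5 ps) ω 5 7).mp hB1.symm
        have : lab ends o a₁ a₂ a₃ b (xsOf5 (exch5 ps 0)) ω 6 ≤ 5 :=
          Nat.find_min' (p := fun j => Conn ends ω (pt o a₁ a₂ a₃ b (xsOf5 (exch5 ps 0)) j) (pt o a₁ a₂ a₃ b (xsOf5 (exch5 ps 0)) 6))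
            ⟨6, conn_refl ends ω _⟩ (by simpa [exch5] using conn_trans (conn_symm hpp) hs3)
        omega
    refine code10_lt_1 ends o a₁ a₂ a₃ b ω (xsOf5 ps) (xsOf5 (exch5 ps 0))  hv ?_
    exact hnew

/-- Exchanging pairs `1` and `2` changes no point before index `7`. -/
lemma pt_exch5_1 (ps : Fin 5 → V × V) (j : ℕ) (hj : j ≤ 6) :
    pt o a₁ a₂ a₃ b (xsOf5 (exch5 ps 1)) j = pt o a₁ a₂ a₃ b (xsOf5 ps) j := by
  interval_cases j <;> rfl

/-- **Exchanging two misordered pairs lowers the code** (pairs `1` and `2`). -/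
lemma code10_exch5_lt_1 (ps : Fin 5 → V × V)
    (h : lab ends o a₁ a₂ a₃ b (xsOf5 ps) ω 9 < lab ends o a₁ a₂ a₃ b (xsOf5 ps) ω 7 ∨
      (lab ends o a₁ a₂ a₃ b (xsOf5 ps) ω 9 = lab ends o a₁ a₂ a₃ b (xsOf5 ps) ω 7 ∧ lab ends o a₁ a₂ a₃ b (xsOf5 ps) ω 10 < lab ends o a₁ a₂ a₃ b (xsOf5 ps) ω 8)) :
    code10 ends o a₁ a₂ a₃ b ω (xsOf5 (exch5 ps 1)) < code10 ends o a₁ a₂ a₃ b ω (xsOf5 ps) := by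
  have hpre : ∀ j ≤ 6, pt o a₁ a₂ a₃ b (xsOf5 (exch5 ps 1)) j = pt o a₁ a₂ a₃ b (xsOf5 ps) j := pt_exch5_1 o a₁ a₂ a₃ b ps
  have hleP := lab_le ends o a₁ a₂ a₃ b (xsOf5 ps) ω 7
  have hleP1 := lab_le ends o a₁ a₂ a₃ b (xsOf5 ps) ω 8
  have hs2 := lab_spec ends o a₁ a₂ a₃ b (xsOf5 ps) ω 9
  have hs3 := lab_spec ends o a₁ a₂ a₃ b (xsOf5 ps) ω 10
  have hmin2 : ∀ n, n < lab ends o a₁ a₂ a₃ b (xsOf5 ps) ω 9 → ¬ Conn ends ω (pt o a₁ a₂ a₃ b (xsOf5 ps) n) (pt o a₁ a₂ a₃ b (xsOf5 ps) 9) :=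
    fun n hn => Nat.find_min (⟨9, conn_refl ends ω (pt o a₁ a₂ a₃ b (xsOf5 ps) 9)⟩ :
      ∃ j, Conn ends ω (pt o a₁ a₂ a₃ b (xsOf5 ps) j) (pt o a₁ a₂ a₃ b (xsOf5 ps) 9)) hn
  rcases h with hA | ⟨hB1, hB2⟩
  · have hj : lab ends o a₁ a₂ a₃ b (xsOf5 ps) ω 9 ≤ 6 := by omega
    have hnew : lab ends o a₁ a₂ a₃ b (xsOf5 (exch5 ps 1)) ω 7 ≤ lab ends o a₁ a₂ a₃ b (xsOf5 ps) ω 9 :=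
      Nat.find_min' (p := fun j => Conn ends ω (pt o a₁ a₂ a₃ b (xsOf5 (exch5 ps 1)) j) (pt o a₁ a₂ a₃ b (xsOf5 (exch5 ps 1)) 7))
        ⟨7, conn_refl ends ω _⟩ (by rw [hpre _ hj]; simpa [exch5] using hs2)
    refine code10_lt_2 ends o a₁ a₂ a₃ b ω (xsOf5 ps) (xsOf5 (exch5 ps 1)) (lab_prefix ends o a₁ a₂ a₃ b _ _ ω 5 (fun i hi => hpre i (by omega))) (lab_prefix ends o a₁ a₂ a₃ b _ _ ω 6 (fun i hi => hpre i (by omega))) ?_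
    omega
  · have hv : lab ends o a₁ a₂ a₃ b (xsOf5 (exch5 ps 1)) ω 7 = lab ends o a₁ a₂ a₃ b (xsOf5 ps) ω 7 := by
      apply le_antisymm
      · rcases Nat.lt_or_ge (lab ends o a₁ a₂ a₃ b (xsOf5 ps) ω 7) 7 with hlt | hge
        · refine Nat.find_min' (p := fun j => Conn ends ω (pt o a₁ a₂ a₃ b (xsOf5 (exch5 ps 1)) j) (pt o a₁ a₂ a₃ b (xsOf5 (exch5 ps 1)) 7))
            ⟨7, conn_refl ends ω _⟩ ?_
          rw [hpre _ (by omega), ← hB1]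
          simpa [exch5] using hs2
        · have := lab_le ends o a₁ a₂ a₃ b (xsOf5 (exch5 ps 1)) ω 7
          omega
      · by_contra hlt
        simp only [not_le] at hlt
        have hs' := lab_spec ends o a₁ a₂ a₃ b (xsOf5 (exch5 ps 1)) ω 7
        rw [hpre _ (by omega)] at hs'
        exact hmin2 (lab ends o a₁ a₂ a₃ b (xsOf5 (exch5 ps 1)) ω 7) (by omega) (by simpa [exch5] using hs')
    have hnew : lab ends o a₁ a₂ a₃ b (xsOf5 (exch5 ps 1)) ω 8 < lab ends o a₁ a₂ a₃ b (xsOf5 ps) ω 8 := by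
      rcases Nat.lt_or_ge (lab ends o a₁ a₂ a₃ b (xsOf5 ps) ω 10) 7 with hlt | hge
      · have : lab ends o a₁ a₂ a₃ b (xsOf5 (exch5 ps 1)) ω 8 ≤ lab ends o a₁ a₂ a₃ b (xsOf5 ps) ω 10 :=
          Nat.find_min' (p := fun j => Conn ends ω (pt o a₁ a₂ a₃ b (xsOf5 (exch5 ps 1)) j) (pt o a₁ a₂ a₃ b (xsOf5 (exch5 ps 1)) 8))
            ⟨8, conn_refl ends ω _⟩ (by rw [hpre _ (by omega)]; simpa [exch5] using hs3)
        omega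
      · have hj3 : lab ends o a₁ a₂ a₃ b (xsOf5 ps) ω 10 = 7 := by omega
        rw [hj3] at hs3
        have hpp : Conn ends ω (pt o a₁ a₂ a₃ b (xsOf5 ps) 7) (pt o a₁ a₂ a₃ b (xsOf5 ps) 9) :=
          (lab_eq_iff ends o a₁ a₂ a₃ b (xsOf5 ps) ω 7 9).mp hB1.symm
        have : lab ends o a₁ a₂ a₃ b (xsOf5 (exch5 ps 1)) ω 8 ≤ 7 :=
          Nat.find_min' (p := fun j => Conn ends ω (pt o a₁ a₂ a₃ b (xsOf5 (exch5 ps 1)) j) (pt o a₁ a₂ a₃ b (xsOf5 (exch5 ps 1)) 8))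
            ⟨8, conn_refl ends ω _⟩ (by simpa [exch5] using conn_trans (conn_symm hpp) hs3)
        omega
    refine code10_lt_3 ends o a₁ a₂ a₃ b ω (xsOf5 ps) (xsOf5 (exch5 ps 1)) (lab_prefix ends o a₁ a₂ a₃ b _ _ ω 5 (fun i hi => hpre i (by omega))) (lab_prefix ends o a₁ a₂ a₃ b _ _ ω 6 (fun i hi => hpre i (by omega))) hv ?_
    exact hnew

/-- Exchanging pairs `2` and `3` changes no point before index `9`. -/
lemma pt_exch5_2 (ps : Fin 5 → V × V) (j : ℕ) (hj : j ≤ 8) :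
    pt o a₁ a₂ a₃ b (xsOf5 (exch5 ps 2)) j = pt o a₁ a₂ a₃ b (xsOf5 ps) j := by
  interval_cases j <;> rfl

/-- **Exchanging two misordered pairs lowers the code** (pairs `2` and `3`). -/
lemma code10_exch5_lt_2 (ps : Fin 5 → V × V)
    (h : lab ends o a₁ a₂ a₃ b (xsOf5 ps) ω 11 < lab ends o a₁ a₂ a₃ b (xsOf5 ps) ω 9 ∨
      (lab ends o a₁ a₂ a₃ b (xsOf5 ps) ω 11 = lab ends o a₁ a₂ a₃ b (xsOf5 ps) ω 9 ∧ lab ends o a₁ a₂ a₃ b (xsOf5 ps) ω 12 < lab ends o a₁ a₂ a₃ b (xsOf5 ps) ω 10)) :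
    code10 ends o a₁ a₂ a₃ b ω (xsOf5 (exch5 ps 2)) < code10 ends o a₁ a₂ a₃ b ω (xsOf5 ps) := by
  have hpre : ∀ j ≤ 8, pt o a₁ a₂ a₃ b (xsOf5 (exch5 ps 2)) j = pt o a₁ a₂ a₃ b (xsOf5 ps) j := pt_exch5_2 o a₁ a₂ a₃ b ps
  have hleP := lab_le ends o a₁ a₂ a₃ b (xsOf5 ps) ω 9
  have hleP1 := lab_le ends o a₁ a₂ a₃ b (xsOf5 ps) ω 10
  have hs2 := lab_spec ends o a₁ a₂ a₃ b (xsOf5 ps) ω 11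
  have hs3 := lab_spec ends o a₁ a₂ a₃ b (xsOf5 ps) ω 12
  have hmin2 : ∀ n, n < lab ends o a₁ a₂ a₃ b (xsOf5 ps) ω 11 → ¬ Conn ends ω (pt o a₁ a₂ a₃ b (xsOf5 ps) n) (pt o a₁ a₂ a₃ b (xsOf5 ps) 11) :=
    fun n hn => Nat.find_min (⟨11, conn_refl ends ω (pt o a₁ a₂ a₃ b (xsOf5 ps) 11)⟩ :
      ∃ j, Conn ends ω (pt o a₁ a₂ a₃ b (xsOf5 ps) j) (pt o a₁ a₂ a₃ b (xsOf5 ps) 11)) hn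
  rcases h with hA | ⟨hB1, hB2⟩
  · have hj : lab ends o a₁ a₂ a₃ b (xsOf5 ps) ω 11 ≤ 8 := by omega
    have hnew : lab ends o a₁ a₂ a₃ b (xsOf5 (exch5 ps 2)) ω 9 ≤ lab ends o a₁ a₂ a₃ b (xsOf5 ps) ω 11 :=
      Nat.find_min' (p := fun j => Conn ends ω (pt o a₁ a₂ a₃ b (xsOf5 (exch5 ps 2)) j) (pt o a₁ a₂ a₃ b (xsOf5 (exch5 ps 2)) 9))
        ⟨9, conn_refl ends ω _⟩ (by rw [hpre _ hj]; simpa [exch5] using hs2)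
    refine code10_lt_4 ends o a₁ a₂ a₃ b ω (xsOf5 ps) (xsOf5 (exch5 ps 2)) (lab_prefix ends o a₁ a₂ a₃ b _ _ ω 5 (fun i hi => hpre i (by omega))) (lab_prefix ends o a₁ a₂ a₃ b _ _ ω 6 (fun i hi => hpre i (by omega))) (lab_prefix ends o a₁ a₂ a₃ b _ _ ω 7 (fun i hi => hpre i (by omega))) (lab_prefix ends o a₁ a₂ a₃ b _ _ ω 8 (fun i hi => hpre i (by omega))) ?_
    omega
  · have hv : lab ends o a₁ a₂ a₃ b (xsOf5 (exch5 ps 2)) ω 9 = lab ends o a₁ a₂ a₃ b (xsOf5 ps) ω 9 := by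
      apply le_antisymm
      · rcases Nat.lt_or_ge (lab ends o a₁ a₂ a₃ b (xsOf5 ps) ω 9) 9 with hlt | hge
        · refine Nat.find_min' (p := fun j => Conn ends ω (pt o a₁ a₂ a₃ b (xsOf5 (exch5 ps 2)) j) (pt o a₁ a₂ a₃ b (xsOf5 (exch5 ps 2)) 9))
            ⟨9, conn_refl ends ω _⟩ ?_
          rw [hpre _ (by omega), ← hB1]
          simpa [exch5] using hs2
        · have := lab_le ends o a₁ a₂ a₃ b (xsOf5 (exch5 ps 2)) ω 9
          omega
      · by_contra hlt
        simp only [not_le] at hlt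
        have hs' := lab_spec ends o a₁ a₂ a₃ b (xsOf5 (exch5 ps 2)) ω 9
        rw [hpre _ (by omega)] at hs'
        exact hmin2 (lab ends o a₁ a₂ a₃ b (xsOf5 (exch5 ps 2)) ω 9) (by omega) (by simpa [exch5] using hs')
    have hnew : lab ends o a₁ a₂ a₃ b (xsOf5 (exch5 ps 2)) ω 10 < lab ends o a₁ a₂ a₃ b (xsOf5 ps) ω 10 := by
      rcases Nat.lt_or_ge (lab ends o a₁ a₂ a₃ b (xsOf5 ps) ω 12) 9 with hlt | hge
      · have : lab ends o a₁ a₂ a₃ b (xsOf5 (exch5 ps 2)) ω 10 ≤ lab ends o a₁ a₂ a₃ b (xsOf5 ps) ω 12 :=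
          Nat.find_min' (p := fun j => Conn ends ω (pt o a₁ a₂ a₃ b (xsOf5 (exch5 ps 2)) j) (pt o a₁ a₂ a₃ b (xsOf5 (exch5 ps 2)) 10))
            ⟨10, conn_refl ends ω _⟩ (by rw [hpre _ (by omega)]; simpa [exch5] using hs3)
        omega
      · have hj3 : lab ends o a₁ a₂ a₃ b (xsOf5 ps) ω 12 = 9 := by omega
        rw [hj3] at hs3
        have hpp : Conn ends ω (pt o a₁ a₂ a₃ b (xsOf5 ps) 9) (pt o a₁ a₂ a₃ b (xsOf5 ps) 11) :=
          (lab_eq_iff ends o a₁ a₂ a₃ b (xsOf5 ps) ω 9 11).mp hB1.symm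
        have : lab ends o a₁ a₂ a₃ b (xsOf5 (exch5 ps 2)) ω 10 ≤ 9 :=
          Nat.find_min' (p := fun j => Conn ends ω (pt o a₁ a₂ a₃ b (xsOf5 (exch5 ps 2)) j) (pt o a₁ a₂ a₃ b (xsOf5 (exch5 ps 2)) 10))
            ⟨10, conn_refl ends ω _⟩ (by simpa [exch5] using conn_trans (conn_symm hpp) hs3)
        omega
    refine code10_lt_5 ends o a₁ a₂ a₃ b ω (xsOf5 ps) (xsOf5 (exch5 ps 2)) (lab_prefix ends o a₁ a₂ a₃ b _ _ ω 5 (fun i hi => hpre i (by omega))) (lab_prefix ends o a₁ a₂ a₃ b _ _ ω 6 (fun i hi => hpre i (by omega))) (lab_prefix ends o a₁ a₂ a₃ b _ _ ω 7 (fun i hi => hpre i (by omega))) (lab_prefix ends o a₁ a₂ a₃ b _ _ ω 8 (fun i hi => hpre i (by omega))) hv ?_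
    exact hnew

/-- Exchanging pairs `3` and `4` changes no point before index `11`. -/
lemma pt_exch5_3 (ps : Fin 5 → V × V) (j : ℕ) (hj : j ≤ 10) :
    pt o a₁ a₂ a₃ b (xsOf5 (exch5 ps 3)) j = pt o a₁ a₂ a₃ b (xsOf5 ps) j := by
  interval_cases j <;> rfl

/-- **Exchanging two misordered pairs lowers the code** (pairs `3` and `4`). -/
lemma code10_exch5_lt_3 (ps : Fin 5 → V × V)
    (h : lab ends o a₁ a₂ a₃ b (xsOf5 ps) ω 13 < lab ends o a₁ a₂ a₃ b (xsOf5 ps) ω 11 ∨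
      (lab ends o a₁ a₂ a₃ b (xsOf5 ps) ω 13 = lab ends o a₁ a₂ a₃ b (xsOf5 ps) ω 11 ∧ lab ends o a₁ a₂ a₃ b (xsOf5 ps) ω 14 < lab ends o a₁ a₂ a₃ b (xsOf5 ps) ω 12)) :
    code10 ends o a₁ a₂ a₃ b ω (xsOf5 (exch5 ps 3)) < code10 ends o a₁ a₂ a₃ b ω (xsOf5 ps) := by
  have hpre : ∀ j ≤ 10, pt o a₁ a₂ a₃ b (xsOf5 (exch5 ps 3)) j = pt o a₁ a₂ a₃ b (xsOf5 ps) j := pt_exch5_3 o a₁ a₂ a₃ b ps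
  have hleP := lab_le ends o a₁ a₂ a₃ b (xsOf5 ps) ω 11
  have hleP1 := lab_le ends o a₁ a₂ a₃ b (xsOf5 ps) ω 12
  have hs2 := lab_spec ends o a₁ a₂ a₃ b (xsOf5 ps) ω 13
  have hs3 := lab_spec ends o a₁ a₂ a₃ b (xsOf5 ps) ω 14
  have hmin2 : ∀ n, n < lab ends o a₁ a₂ a₃ b (xsOf5 ps) ω 13 → ¬ Conn ends ω (pt o a₁ a₂ a₃ b (xsOf5 ps) n) (pt o a₁ a₂ a₃ b (xsOf5 ps) 13) :=
    fun n hn => Nat.find_min (⟨13, conn_refl ends ω (pt o a₁ a₂ a₃ b (xsOf5 ps) 13)⟩ :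
      ∃ j, Conn ends ω (pt o a₁ a₂ a₃ b (xsOf5 ps) j) (pt o a₁ a₂ a₃ b (xsOf5 ps) 13)) hn
  rcases h with hA | ⟨hB1, hB2⟩
  · have hj : lab ends o a₁ a₂ a₃ b (xsOf5 ps) ω 13 ≤ 10 := by omega
    have hnew : lab ends o a₁ a₂ a₃ b (xsOf5 (exch5 ps 3)) ω 11 ≤ lab ends o a₁ a₂ a₃ b (xsOf5 ps) ω 13 :=
      Nat.find_min' (p := fun j => Conn ends ω (pt o a₁ a₂ a₃ b (xsOf5 (exch5 ps 3)) j) (pt o a₁ a₂ a₃ b (xsOf5 (exch5 ps 3)) 11))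
        ⟨11, conn_refl ends ω _⟩ (by rw [hpre _ hj]; simpa [exch5] using hs2)
    refine code10_lt_6 ends o a₁ a₂ a₃ b ω (xsOf5 ps) (xsOf5 (exch5 ps 3)) (lab_prefix ends o a₁ a₂ a₃ b _ _ ω 5 (fun i hi => hpre i (by omega))) (lab_prefix ends o a₁ a₂ a₃ b _ _ ω 6 (fun i hi => hpre i (by omega))) (lab_prefix ends o a₁ a₂ a₃ b _ _ ω 7 (fun i hi => hpre i (by omega))) (lab_prefix ends o a₁ a₂ a₃ b _ _ ω 8 (fun i hi => hpre i (by omega))) (lab_prefix ends o a₁ a₂ a₃ b _ _ ω 9 (fun i hi => hpre i (by omega))) (lab_prefix ends o a₁ a₂ a₃ b _ _ ω 10 (fun i hi => hpre i (by omega))) ?_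
    omega
  · have hv : lab ends o a₁ a₂ a₃ b (xsOf5 (exch5 ps 3)) ω 11 = lab ends o a₁ a₂ a₃ b (xsOf5 ps) ω 11 := by
      apply le_antisymm
      · rcases Nat.lt_or_ge (lab ends o a₁ a₂ a₃ b (xsOf5 ps) ω 11) 11 with hlt | hge
        · refine Nat.find_min' (p := fun j => Conn ends ω (pt o a₁ a₂ a₃ b (xsOf5 (exch5 ps 3)) j) (pt o a₁ a₂ a₃ b (xsOf5 (exch5 ps 3)) 11))
            ⟨11, conn_refl ends ω _⟩ ?_
          rw [hpre _ (by omega), ← hB1]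
          simpa [exch5] using hs2
        · have := lab_le ends o a₁ a₂ a₃ b (xsOf5 (exch5 ps 3)) ω 11
          omega
      · by_contra hlt
        simp only [not_le] at hlt
        have hs' := lab_spec ends o a₁ a₂ a₃ b (xsOf5 (exch5 ps 3)) ω 11
        rw [hpre _ (by omega)] at hs'
        exact hmin2 (lab ends o a₁ a₂ a₃ b (xsOf5 (exch5 ps 3)) ω 11) (by omega) (by simpa [exch5] using hs')
    have hnew : lab ends o a₁ a₂ a₃ b (xsOf5 (exch5 ps 3)) ω 12 < lab ends o a₁ a₂ a₃ b (xsOf5 ps) ω 12 := by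
      rcases Nat.lt_or_ge (lab ends o a₁ a₂ a₃ b (xsOf5 ps) ω 14) 11 with hlt | hge
      · have : lab ends o a₁ a₂ a₃ b (xsOf5 (exch5 ps 3)) ω 12 ≤ lab ends o a₁ a₂ a₃ b (xsOf5 ps) ω 14 :=
          Nat.find_min' (p := fun j => Conn ends ω (pt o a₁ a₂ a₃ b (xsOf5 (exch5 ps 3)) j) (pt o a₁ a₂ a₃ b (xsOf5 (exch5 ps 3)) 12))
            ⟨12, conn_refl ends ω _⟩ (by rw [hpre _ (by omega)]; simpa [exch5] using hs3)
        omega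
      · have hj3 : lab ends o a₁ a₂ a₃ b (xsOf5 ps) ω 14 = 11 := by omega
        rw [hj3] at hs3
        have hpp : Conn ends ω (pt o a₁ a₂ a₃ b (xsOf5 ps) 11) (pt o a₁ a₂ a₃ b (xsOf5 ps) 13) :=
          (lab_eq_iff ends o a₁ a₂ a₃ b (xsOf5 ps) ω 11 13).mp hB1.symm
        have : lab ends o a₁ a₂ a₃ b (xsOf5 (exch5 ps 3)) ω 12 ≤ 11 :=
          Nat.find_min' (p := fun j => Conn ends ω (pt o a₁ a₂ a₃ b (xsOf5 (exch5 ps 3)) j) (pt o a₁ a₂ a₃ b (xsOf5 (exch5 ps 3)) 12))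
            ⟨12, conn_refl ends ω _⟩ (by simpa [exch5] using conn_trans (conn_symm hpp) hs3)
        omega
    refine code10_lt_7 ends o a₁ a₂ a₃ b ω (xsOf5 ps) (xsOf5 (exch5 ps 3)) (lab_prefix ends o a₁ a₂ a₃ b _ _ ω 5 (fun i hi => hpre i (by omega))) (lab_prefix ends o a₁ a₂ a₃ b _ _ ω 6 (fun i hi => hpre i (by omega))) (lab_prefix ends o a₁ a₂ a₃ b _ _ ω 7 (fun i hi => hpre i (by omega))) (lab_prefix ends o a₁ a₂ a₃ b _ _ ω 8 (fun i hi => hpre i (by omega))) (lab_prefix ends o a₁ a₂ a₃ b _ _ ω 9 (fun i hi => hpre i (by omega))) (lab_prefix ends o a₁ a₂ a₃ b _ _ ω 10 (fun i hi => hpre i (by omega))) hv ?_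
    exact hnew

/-- Toggling the swap flag of pair `k` swaps its ends in the acted list. -/
lemma act5_update (σ : Equiv.Perm (Fin 5)) (fl : Fin 5 → Bool) (ps : Fin 5 → V × V) (k : Fin 5) :
    act5 σ (Function.update fl k (!fl k)) ps = swapAt5 (act5 σ fl ps) k := by
  funext i
  by_cases hi : i = k
  · subst hi
    simp only [act5, swapAt5, Function.update_self]
    cases fl i <;> simp
  · simp only [act5, swapAt5, Function.update_of_ne hi]

/-- Composing with the transposition of `k` and `k + 1` exchanges the two pairs in the acted list. -/
lemma act5_swap (σ : Equiv.Perm (Fin 5)) (fl : Fin 5 → Bool) (ps : Fin 5 → V × V) (k : Fin 5) :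
    act5 ((Equiv.swap k (k + 1)).trans σ) (fl ∘ Equiv.swap k (k + 1)) ps = exch5 (act5 σ fl ps) k := by
  funext i
  simp only [act5, exch5, Equiv.trans_apply, Function.comp]

/-- **Every list of 5 pairs has a sorted member in its orbit**: the member of least code
under pair permutations and end swaps is sorted. -/
theorem exists_sorted5 (ps : Fin 5 → V × V) :
    ∃ (σ : Equiv.Perm (Fin 5)) (fl : Fin 5 → Bool), Sorted10 ends o a₁ a₂ a₃ b ω (act5 σ fl ps) := by
  obtain ⟨g, hmin⟩ := Finite.exists_min
    (fun g : Equiv.Perm (Fin 5) × (Fin 5 → Bool) => code10 ends o a₁ a₂ a₃ b ω (xsOf5 (act5 g.1 g.2 ps)))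
  refine ⟨g.1, g.2, ?_, ?_, ?_, ?_, ?_, ?_, ?_, ?_, ?_⟩
  · by_contra h
    simp only [not_le] at h
    have hm := hmin (g.1, Function.update g.2 0 (!g.2 0))
    simp only [act5_update] at hm
    exact absurd (code10_swapAt5_lt_0 ends o a₁ a₂ a₃ b ω _ h) (not_lt.mpr hm)
  · by_contra h
    simp only [not_le] at h
    have hm := hmin (g.1, Function.update g.2 1 (!g.2 1))
    simp only [act5_update] at hm
    exact absurd (code10_swapAt5_lt_1 ends o a₁ a₂ a₃ b ω _ h) (not_lt.mpr hm)
  · by_contra h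
    simp only [not_le] at h
    have hm := hmin (g.1, Function.update g.2 2 (!g.2 2))
    simp only [act5_update] at hm
    exact absurd (code10_swapAt5_lt_2 ends o a₁ a₂ a₃ b ω _ h) (not_lt.mpr hm)
  · by_contra h
    simp only [not_le] at h
    have hm := hmin (g.1, Function.update g.2 3 (!g.2 3))
    simp only [act5_update] at hm
    exact absurd (code10_swapAt5_lt_3 ends o a₁ a₂ a₃ b ω _ h) (not_lt.mpr hm)
  · by_contra h
    simp only [not_le] at h
    have hm := hmin (g.1, Function.update g.2 4 (!g.2 4))
    simp only [act5_update] at hm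
    exact absurd (code10_swapAt5_lt_4 ends o a₁ a₂ a₃ b ω _ h) (not_lt.mpr hm)
  · by_contra h
    have h' : lab ends o a₁ a₂ a₃ b (xsOf5 (act5 g.1 g.2 ps)) ω 7 < lab ends o a₁ a₂ a₃ b (xsOf5 (act5 g.1 g.2 ps)) ω 5 ∨
        (lab ends o a₁ a₂ a₃ b (xsOf5 (act5 g.1 g.2 ps)) ω 7 = lab ends o a₁ a₂ a₃ b (xsOf5 (act5 g.1 g.2 ps)) ω 5 ∧
          lab ends o a₁ a₂ a₃ b (xsOf5 (act5 g.1 g.2 ps)) ω 8 < lab ends o a₁ a₂ a₃ b (xsOf5 (act5 g.1 g.2 ps)) ω 6) := by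
      simp only [not_or, not_lt, not_and] at h
      omega
    have hm := hmin ((Equiv.swap (0 : Fin 5) (0 + 1)).trans g.1, g.2 ∘ Equiv.swap (0 : Fin 5) (0 + 1))
    simp only [act5_swap] at hm
    exact absurd (code10_exch5_lt_0 ends o a₁ a₂ a₃ b ω _ h') (not_lt.mpr hm)
  · by_contra h
    have h' : lab ends o a₁ a₂ a₃ b (xsOf5 (act5 g.1 g.2 ps)) ω 9 < lab ends o a₁ a₂ a₃ b (xsOf5 (act5 g.1 g.2 ps)) ω 7 ∨
        (lab ends o a₁ a₂ a₃ b (xsOf5 (act5 g.1 g.2 ps)) ω 9 = lab ends o a₁ a₂ a₃ b (xsOf5 (act5 g.1 g.2 ps)) ω 7 ∧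
          lab ends o a₁ a₂ a₃ b (xsOf5 (act5 g.1 g.2 ps)) ω 10 < lab ends o a₁ a₂ a₃ b (xsOf5 (act5 g.1 g.2 ps)) ω 8) := by
      simp only [not_or, not_lt, not_and] at h
      omega
    have hm := hmin ((Equiv.swap (1 : Fin 5) (1 + 1)).trans g.1, g.2 ∘ Equiv.swap (1 : Fin 5) (1 + 1))
    simp only [act5_swap] at hm
    exact absurd (code10_exch5_lt_1 ends o a₁ a₂ a₃ b ω _ h') (not_lt.mpr hm)
  · by_contra h
    have h' : lab ends o a₁ a₂ a₃ b (xsOf5 (act5 g.1 g.2 ps)) ω 11 < lab ends o a₁ a₂ a₃ b (xsOf5 (act5 g.1 g.2 ps)) ω 9 ∨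
        (lab ends o a₁ a₂ a₃ b (xsOf5 (act5 g.1 g.2 ps)) ω 11 = lab ends o a₁ a₂ a₃ b (xsOf5 (act5 g.1 g.2 ps)) ω 9 ∧
          lab ends o a₁ a₂ a₃ b (xsOf5 (act5 g.1 g.2 ps)) ω 12 < lab ends o a₁ a₂ a₃ b (xsOf5 (act5 g.1 g.2 ps)) ω 10) := by
      simp only [not_or, not_lt, not_and] at h
      omega
    have hm := hmin ((Equiv.swap (2 : Fin 5) (2 + 1)).trans g.1, g.2 ∘ Equiv.swap (2 : Fin 5) (2 + 1))
    simp only [act5_swap] at hm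
    exact absurd (code10_exch5_lt_2 ends o a₁ a₂ a₃ b ω _ h') (not_lt.mpr hm)
  · by_contra h
    have h' : lab ends o a₁ a₂ a₃ b (xsOf5 (act5 g.1 g.2 ps)) ω 13 < lab ends o a₁ a₂ a₃ b (xsOf5 (act5 g.1 g.2 ps)) ω 11 ∨
        (lab ends o a₁ a₂ a₃ b (xsOf5 (act5 g.1 g.2 ps)) ω 13 = lab ends o a₁ a₂ a₃ b (xsOf5 (act5 g.1 g.2 ps)) ω 11 ∧
          lab ends o a₁ a₂ a₃ b (xsOf5 (act5 g.1 g.2 ps)) ω 14 < lab ends o a₁ a₂ a₃ b (xsOf5 (act5 g.1 g.2 ps)) ω 12) := by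
      simp only [not_or, not_lt, not_and] at h
      omega
    have hm := hmin ((Equiv.swap (3 : Fin 5) (3 + 1)).trans g.1, g.2 ∘ Equiv.swap (3 : Fin 5) (3 + 1))
    simp only [act5_swap] at hm
    exact absurd (code10_exch5_lt_3 ends o a₁ a₂ a₃ b ω _ h') (not_lt.mpr hm)

end Sorted5

end TwoTyped

end CovForm

end Summit.Ventures.PercRepro2
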